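import Mathlib

/-!
# Sketch — crux-ideate round 2, ideator 6, crux `DlogGraphFlat` (stmt-QuantumAdvantage-10732)

First lemmas of the idea `lattice-shift-second-differencing` (heavy-Walsh core and residual (R1)
"dilation correlations of a binary digital function mod p, T(χ,c) = Σ_u χ(u) w(u) w(cu mod p)").
Only statements; `sorry`/`Prop` defs. Everything is over Mathlib (`ZMod.dft`, `MulChar`).
-/

noncomputable section
set_option linter.dupNamespace false

open scoped BigOperators
open Finset

namespace Summit.QuantumAdvantage.QuantumAdvantage.Cruxes.DlogGraphFlat.LatticeShift

/-- The binary digital sign `w_b(z) = (−1)^{popcount(z AND b)}` (mask `b`, argument `z`, both naturals). -/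
def digitSign (b z : ℕ) : ℂ := (-1 : ℂ) ^ ((Nat.land z b).bits.count true)

/-- The DIFFERENCED digital function at shift `r` on `λ` digits, as a function on `ℤ/2^λ`:
`g_{b,r}(z) = w_b(z) · w_b((z + r) mod 2^λ)`. -/
def diffFn (b lam r : ℕ) : ZMod (2 ^ lam) → ℂ :=
  fun z => digitSign b z.val * digitSign b ((z.val + r) % 2 ^ lam)

/-- `b` is `θ`-dense in every window of `L` consecutive digit positions below `lam`. -/
def WindowDense (θ : ℝ) (L lam b : ℕ) : Prop :=
  ∀ i : ℕ, i + L ≤ lam → θ * L ≤ (((Finset.Ico i (i + L)).filter fun j => Nat.testBit b j).card : ℝ)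

instance (lam : ℕ) : NeZero (2 ^ lam) := ⟨pow_ne_zero _ two_ne_zero⟩

/-- **DFP (differenced Fourier property, sup form).** For window-dense masks, all but an
exponentially small set of shifts `r < 2^λ` give a differenced function whose (unnormalised)
discrete Fourier transform is uniformly `≤ 2^{(1−η)λ}`. (2-adic / transfer-matrix statement; no `p`.) -/
def DiffFourierSup (θ : ℝ) (L : ℕ) (η : ℝ) : Prop :=
  ∃ κ : ℝ, 0 < κ ∧ ∃ lam₀ : ℕ, ∀ lam ≥ lam₀, ∀ b < 2 ^ lam, WindowDense θ L lam b →
    ((((Finset.range (2 ^ lam)).filter fun r =>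
        ∃ t : ZMod (2 ^ lam), (2 : ℝ) ^ ((1 - η) * lam) < ‖ZMod.dft (diffFn b lam r) t‖).card : ℝ)
      ≤ (2 : ℝ) ^ ((1 - κ) * lam))

/-- **DRB (differenced Riesz budget, ℓ¹ form).** Same, for the ℓ¹ norm of the transform:
`Σ_t ‖𝓕 g_{b,r}(t)‖ ≤ 2^λ · 2^{(1/2−η')λ}` (trivial exponent is `1/2`; the claim is `η' > 0`). -/
def DiffRieszBudget (θ : ℝ) (L : ℕ) (η' : ℝ) : Prop :=
  ∃ κ : ℝ, 0 < κ ∧ ∃ lam₀ : ℕ, ∀ lam ≥ lam₀, ∀ b < 2 ^ lam, WindowDense θ L lam b →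
    ((((Finset.range (2 ^ lam)).filter fun r =>
        (2 : ℝ) ^ (lam : ℝ) * (2 : ℝ) ^ ((1 / 2 - η') * lam) <
          ∑ t : ZMod (2 ^ lam), ‖ZMod.dft (diffFn b lam r) t‖).card : ℝ)
      ≤ (2 : ℝ) ^ ((1 - κ) * lam))

/-- **Van der Corput with an arbitrary finite shift set** in `ℤ/p` (the lattice shifts are plugged
in here): `‖Σ_u F u‖² ≤ (p/|H|²) Σ_{h,h'∈H} ‖Σ_u F(u+h) conj F(u+h')‖`. Elementary (shift-invariance
of `Σ_u` + Cauchy–Schwarz). -/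
theorem vdC_shiftSet (p : ℕ) [NeZero p] (F : ZMod p → ℂ) (H : Finset (ZMod p)) (hH : H.Nonempty) :
    ‖∑ u : ZMod p, F u‖ ^ 2 ≤
      ((p : ℝ) / (H.card : ℝ) ^ 2) *
        ∑ h ∈ H, ∑ h' ∈ H, ‖∑ u : ZMod p, F (u + h) * (starRingEnd ℂ) (F (u + h'))‖ := by
  sorry

/-- **Weil + completion step (χ ≠ 1).** After a lattice shift `(r, s)` with `s ≡ c r`, both digital
factors are periodic modulo `2^λ'` ("two-sided carry truncation"), and the differenced sum is a
double Fourier series of complete sums `Σ_u χ((u+r)/u) e(au/p) ≪ √p`; hence it is bounded by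
`√p (log p)²` times the two normalised ℓ¹ Fourier norms. Stated as a Prop (a stub of the line). -/
def WeilCompletionStep : Prop :=
  ∀ (p : ℕ) [Fact p.Prime] (c : (ZMod p)ˣ) (r : ZMod p), r ≠ 0 →
  ∀ (χ : MulChar (ZMod p) ℂ), χ ≠ 1 →
  ∀ (lam' : ℕ) (G₁ G₂ : ZMod (2 ^ lam') → ℂ), (∀ z, ‖G₁ z‖ ≤ 1) → (∀ z, ‖G₂ z‖ ≤ 1) →
    ‖∑ u : ZMod p, χ ((u + r) * u⁻¹) * G₁ ((u.val : ℕ) : ZMod (2 ^ lam')) *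
        G₂ (((c : ZMod p) * u).val : ZMod (2 ^ lam'))‖ ≤
      64 * (Real.log p) ^ 2 * Real.sqrt p *
        ((∑ t : ZMod (2 ^ lam'), ‖ZMod.dft G₁ t‖) / 2 ^ lam') *
        ((∑ t : ZMod (2 ^ lam'), ‖ZMod.dft G₂ t‖) / 2 ^ lam')

/-- **Bijection step (χ = 1).** In lattice coordinates `(u, cu mod p) = i·e₁ + j·e₂` the periodic
weights have frequencies `(θ₁, θ₂) = Bᵀ(k,k')/2^λ'`, and `det B = p` is odd, so `(k,k') ↦ (θ₁,θ₂)`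
is a bijection of `(ℤ/2^λ')²`; the 2-D geometric sums then give a bound by the two sup-norms of the
Fourier transforms times `(I₀ + λ'2^λ')(J₀ + λ'2^λ')`, where `I₀ J₀ ≍ p` are the coordinate ranges
(`ℓ` = sup-norm of a shortest vector of the lattice `{(u,v) : v ≡ c u (mod p)}`). -/
def BijectionStep : Prop :=
  ∀ (p : ℕ) [Fact p.Prime] (c : (ZMod p)ˣ) (a₁ c₁ a₂ c₂ : ℤ) (ℓ : ℕ), 0 < ℓ →
    a₁ * c₂ - a₂ * c₁ = p → ((c : ZMod p) * (a₁ : ZMod p) = (c₁ : ZMod p)) →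
    ((c : ZMod p) * (a₂ : ZMod p) = (c₂ : ZMod p)) →
    max |a₁| |c₁| = ℓ → max |a₂| |c₂| ≤ 4 * p / ℓ →
  ∀ (lam' : ℕ) (G₁ G₂ : ZMod (2 ^ lam') → ℂ) (M₁ M₂ : ℝ),
    (∀ t, ‖ZMod.dft G₁ t‖ ≤ M₁ * 2 ^ lam') → (∀ t, ‖ZMod.dft G₂ t‖ ≤ M₂ * 2 ^ lam') →
    ‖∑ u : ZMod p, G₁ ((u.val : ℕ) : ZMod (2 ^ lam')) * G₂ (((c : ZMod p) * u).val : ZMod (2 ^ lam'))‖ ≤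
      M₁ * M₂ * (8 * p / ℓ + lam' * 2 ^ lam') * (8 * ℓ + lam' * 2 ^ lam')


/-- **Two-multiplier Fourier decay (regime III, χ = 1).** For coprime multipliers `j₀, d₀ < 2^{τ n}` with
`d₀/j₀ ∉ ±2^ℤ`, every pair of additive constants and every frequency, the two-multiplier digital function
`F(z) = w_b(j₀ z + α) · w_b(d₀ z + β)` on `ℤ/2^n` has all Fourier coefficients `≤ 2^{(1−η₂)n}` (unnormalised
`ZMod.dft`). Fixed `(j₀,d₀)`: Schmid 1984 / Kim 1999 territory; the uniformity in `j₀, d₀ < 2^{τn}` is the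
line's open corner. -/
def TwoMultiplierFourierDecay (θ : ℝ) (L : ℕ) (τ η₂ : ℝ) : Prop :=
  ∃ n₀ : ℕ, ∀ n ≥ n₀, ∀ b < 2 ^ n, WindowDense θ L n b →
  ∀ j₀ d₀ : ℕ, 0 < j₀ → 0 < d₀ → Nat.Coprime j₀ d₀ → (j₀ : ℝ) < (2 : ℝ) ^ (τ * n) →
    (d₀ : ℝ) < (2 : ℝ) ^ (τ * n) → (∀ e : ℕ, ¬ (j₀ = 1 ∧ d₀ = 2 ^ e) ∧ ¬ (d₀ = 1 ∧ j₀ = 2 ^ e)) →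
  ∀ α β : ZMod (2 ^ n), ∀ t : ZMod (2 ^ n),
    ‖ZMod.dft (fun z : ZMod (2 ^ n) =>
        digitSign b (((j₀ : ZMod (2 ^ n)) * z + α).val) * digitSign b (((d₀ : ZMod (2 ^ n)) * z + β).val)) t‖
      ≤ (2 : ℝ) ^ ((1 - η₂) * n)

/-- **Regime III, χ ≠ 1 (low lattice height), mask-free.** If `j₀ c = d₀` in `ℤ/p` with
`max(j₀,d₀) = ℓ`, then small-shift van der Corput + one-sided carry truncation (both digital factors are
functions of `z` with `u = j₀ z`) + Weil give a saving `p^{−1/6} ℓ^{1/2}` up to logarithms — no Riesz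
exponent of the mask enters. -/
def LowHeightNontrivialChar : Prop :=
  ∃ C : ℝ, 0 < C ∧ ∀ (p : ℕ) [Fact p.Prime] (n : ℕ), p < 2 ^ n → 2 ^ n < 2 * p →
  ∀ b < 2 ^ n, ∀ (j₀ d₀ : ℕ), 0 < j₀ → 0 < d₀ → j₀ < p → d₀ < p →
  ∀ (c : (ZMod p)ˣ), (j₀ : ZMod p) * (c : ZMod p) = (d₀ : ZMod p) →
  ∀ χ : MulChar (ZMod p) ℂ, χ ≠ 1 →
    ‖∑ u : ZMod p, χ u * digitSign b u.val * digitSign b (((c : ZMod p) * u).val)‖ ≤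
      C * (n : ℝ) ^ 4 * (p : ℝ) ^ (5 / 6 : ℝ) * Real.sqrt (max j₀ d₀)

/-- **The dilation-correlation target (R1) this line closes, generic-height form.** For masks dense in
windows, every prime `p < 2^n` in the crux window, every unit `c` whose lattice has shortest vector
`ℓ ≥ p^{ε}`, and every multiplicative character `χ` (trivial or not):
`|Σ_{u<p} χ(u) w_b(u) w_b(cu mod p)| ≤ 2^{(1−δ₁)n}`. -/
def DilationCorrelationBound (θ : ℝ) (L : ℕ) (ε δ₁ : ℝ) : Prop :=
  ∃ n₀ : ℕ, ∀ n ≥ n₀, ∀ (p : ℕ) [Fact p.Prime], p < 2 ^ n → 2 ^ n ≤ p + 2 ^ (53 * n / 100) →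
  ∀ b < 2 ^ n, WindowDense θ L n b →
  ∀ (c : (ZMod p)ˣ), (∀ j d : ℤ, (j : ZMod p) * (c : ZMod p) = (d : ZMod p) → (j, d) ≠ (0, 0) →
      (p : ℝ) ^ ε ≤ max |j| |d|) →
  ∀ χ : MulChar (ZMod p) ℂ,
    ‖∑ u : ZMod p, χ u * digitSign b u.val * digitSign b (((c : ZMod p) * u).val)‖ ≤
      (2 : ℝ) ^ ((1 - δ₁) * n)

/-- **Composition claimed by the card** (to be the skeleton's spine in crux-plan): DFP + DRB +
the two steps give (R1) at every height `≥ p^ε`. -/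
theorem dilationCorrelation_of_DFP_DRB (θ : ℝ) (L : ℕ) (η η' ε : ℝ) (hη : 0 < η) (hη' : 0 < η')
    (hε : 0 < ε) :
    DiffFourierSup θ L η → DiffRieszBudget θ L η' → WeilCompletionStep → BijectionStep →
      ∃ δ₁ : ℝ, 0 < δ₁ ∧ DilationCorrelationBound θ L ε δ₁ := by
  sorry

end Summit.QuantumAdvantage.QuantumAdvantage.Cruxes.DlogGraphFlat.LatticeShift
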